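/- Lead `ym-line-cbag-p1`, route `ColdBoxAllGroups`, crux `BoxFloorAllGroups` (stmt-QuantumFields-22254), stub S2. -/
import Summits.QuantumFields.YangMills.Theorems.WeakCouplingRatesColdBoxOneScaleDefs
import Summits.QuantumFields.YangMills.Theorems.ColdBoxAllGroupsBoxFloorAllGroupsLargeFieldG
import Summits.QuantumFields.YangMills.Theorems.EquipartitionCriticalityFreeEnergyLogCoefficientExpChartBasic

/-!
# Crux `BoxFloorAllGroups` (every compact simple `G`), stub S2 `stub_boxDirichletDominationAbsG`: the OBJECTS of the one-scale
# expansion of the cold-wall box in the EXPONENTIAL chart, with `D = dimE ρ` colour copies of the Dirichlet Gaussian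

`G`-generic counterpart of `Theorems/WeakCouplingRatesColdBoxOneScaleDefs.lean` (the `SU(2)` objects of the proved crux
`ColdBoxTwoPointFloorW`, gnomonic chart, three colours).  For a representation `ρ : G →* M_N(ℂ)` (faithful, continuous, unitary
where stated) with exponential chart `ψ = expChart ρ : ℝ^D → G`, `D = dimE ρ` (`Theorems/EquipartitionCriticality…Defs`):

* `coldGoodSetG ρ β ε H` — the small-field event of the cold box `Λ = boxEdges 4 (2H+1)`: every plaquette touching `Λ` costs
  `N − Re tr ρ(U_p) < β^{2ε−1}` (the `SU(2)` `coldGoodSet` is its instance);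
* `chartCfgE ρ w` — the configuration whose every link is the chart point `ψ(extZero w e)` (free links `ψ(w_e)`, forest links and the
  cold wall `ψ 0 = 1`); `coldExt_coldExt₁_expChart`;
* `TSpaceD H D = Fin D → EuclideanSpace ℝ (DirFree H)` — `D` colour copies of the D1' variables, `gaussD H D = boxDirichlet H ^{⊗D}`,
  `qObsD H D p t = ½ Σ_i (dirCirc H p (t i))²` (the quadratic surrogate of `β·cost_p`; `TSpace/gauss3/qObs` are the case `D = 3`);
* `unscaleTE H D β t` — the free-link chart data `a_e = (t^i_e)_i / √β` read through `dirFreeEquiv`, `scaleTE` its inverse and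
  `scaleEquivE` the linear equivalence; **`extZero_unscaleTE_apply`**: `(extZero (unscaleTE t) e)_i = dirGlue H (t i) e / √β`;
* `cfgTE ρ H β t = chartCfgE ρ (unscaleTE H D β t)`, `goodTE ρ H β ε` — the small-field event read in `t`, and the TILT
  `tiltWE ρ H g β t = Σ_{p touching Λ} (qObsD p t − β·cost_p(cfgTE t)) + Σ_e log g(a_e)` for a (normalised) chart density `g`
  (the Haar measure in the chart is `c_H·g·Lebesgue` on small balls with `κE(r)^{−D} ≤ g ≤ 1`, `Theorems/…StubExpChartPackage`; the
  density is a PARAMETER here and is produced in the representation file);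
* measurability of all of the above.
Definitions + elementary API only; no analysis.  No sorry; standard axioms.  NOT a claim about the mass gap.
-/

set_option autoImplicit false

noncomputable section

open MeasureTheory Finset
open Literature.Probability.LatticeModels (Site)
open Literature.MathematicalPhysics.QuantumLattice
open Literature.MathematicalPhysics.QuantumFieldTheory
open Literature.MathematicalPhysics.QuantumFieldTheory.LatticeMaxwell
open Literature.MathematicalPhysics.QuantumFieldTheory.AxialGauge
open Summit.QuantumFields.YangMills.Theorems.WeakCouplingRates
open Summit.QuantumFields.YangMills.Theorems.FreeEnergyLogCoefficient

namespace Summit.QuantumFields.YangMills.Theorems.ColdBoxAllGroups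

variable {N : ℕ} {G : Type*} [Group G] (ρ : G →* Matrix (Fin N) (Fin N) ℂ) {H : ℕ}

/-! ## The small-field event -/

variable (H) in
/-- **The small-field (good) event** of the cold box at scale `β^{2ε−1}` for the representation `ρ`: every plaquette touching
`Λ = boxEdges 4 (2H+1)` costs `N − Re tr ρ(U_p) < β^{2ε−1}`.  Its complement is the large-field event of stub S1
`stub_boxLargeFieldRarityG`. -/
def coldGoodSetG (β ε : ℝ) : Set (LGConfig 4 G) :=
  {U | ∃ p ∈ plaquettesTouching (boxEdges 4 (2 * H + 1)),
      β ^ (2 * ε - 1) ≤ (N : ℝ) - plaquetteObs ρ p.1 p.2.1.1 p.2.1.2 U}ᶜ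

/-- Membership in the good event: every plaquette touching the box costs `< β^{2ε−1}`. -/
theorem mem_coldGoodSetG_iff (β ε : ℝ) (U : LGConfig 4 G) :
    U ∈ coldGoodSetG ρ H β ε ↔ ∀ p ∈ plaquettesTouching (boxEdges 4 (2 * H + 1)),
      plaqCostAt ρ p.1 p.2.1.1 p.2.1.2 U < β ^ (2 * ε - 1) := by
  simp only [coldGoodSetG, Set.mem_compl_iff, Set.mem_setOf_eq, not_exists, not_and, not_le, plaqCostAt]

section Meas

variable [TopologicalSpace G] [IsTopologicalGroup G] [MeasurableSpace G] [BorelSpace G] [SecondCountableTopology G]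

/-- The plaquette cost is measurable (continuous representation). -/
theorem measurable_plaqCostAt_of_continuous (hρ : Continuous ρ) (x : Site 4) (i j : Fin 4) :
    Measurable (plaqCostAt ρ x i j) := by
  have hc : Continuous fun U : LGConfig 4 G => (N : ℝ) - plaquetteObs ρ x i j U := by
    unfold plaquetteObs plaquetteHolonomyZd
    fun_prop
  exact hc.measurable

/-- The good event is measurable. -/
theorem measurableSet_coldGoodSetG (hρ : Continuous ρ) (β ε : ℝ) : MeasurableSet (coldGoodSetG ρ H β ε) :=
  (measurableSet_exists_plaqCost_ge_of_rep ρ hρ _ _).compl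

end Meas

/-! ## Zero extension through a map fixing the origin -/

/-- A map with `φ 0 = 0` commutes with `extZero`: `φ (extZero w e) = extZero (φ ∘ w) e`. -/
theorem map_extZero {V W : Type*} [Zero V] [Zero W] (φ : V → W) (hφ : φ 0 = 0) (w : ColdFreeIdx H → V)
    (e : Literature.MathematicalPhysics.QuantumLattice.ZdEdge 4) : φ (extZero w e) = extZero (fun f => φ (w f)) e := by
  unfold extZero
  split_ifs <;> simp [hφ]

/-! ## The chart configuration -/

/-- **The chart configuration** of free-link chart data `w`: every link of `ℤ⁴` is the exponential-chart point `ψ(extZero w e)`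
(free links `ψ(w_e)`, forest links and the cold wall `ψ 0 = 1`). -/
def chartCfgE (w : ColdFreeIdx H → EuclideanSpace ℝ (Fin (dimE ρ))) : LGConfig 4 G :=
  fun e => expChart ρ (extZero w e)

/-- `chartCfgE` unfolded. -/
theorem chartCfgE_apply (w : ColdFreeIdx H → EuclideanSpace ℝ (Fin (dimE ρ))) (e : Literature.MathematicalPhysics.QuantumLattice.ZdEdge 4) :
    chartCfgE ρ w e = expChart ρ (extZero w e) := rfl

section Chart

variable [TopologicalSpace G] [CompactSpace G]

/-- The gauge-fixed cold-wall configuration with chart links is the chart configuration (faithful continuous `ρ`). -/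
theorem coldExt_coldExt₁_expChart (hρ : Continuous ρ) (hinj : Function.Injective ρ)
    (w : ColdFreeIdx H → EuclideanSpace ℝ (Fin (dimE ρ))) :
    coldExt (coldExt₁ (fun e => expChart ρ (w e))) = chartCfgE ρ w :=
  coldExt_coldExt₁_comp (expChart ρ) (expChart_zero ρ hρ hinj) w

/-- The chart configuration is `1` off the cold box. -/
theorem chartCfgE_of_not_mem (hρ : Continuous ρ) (hinj : Function.Injective ρ)
    (w : ColdFreeIdx H → EuclideanSpace ℝ (Fin (dimE ρ))) {e : Literature.MathematicalPhysics.QuantumLattice.ZdEdge 4}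
    (he : e ∉ boxEdges 4 (2 * H + 1)) : chartCfgE ρ w e = 1 := by
  rw [chartCfgE_apply, extZero_of_not_mem w he, expChart_zero ρ hρ hinj]

/-- The chart configuration is `1` on the forest. -/
theorem chartCfgE_of_forest (hρ : Continuous ρ) (hinj : Function.Injective ρ)
    (w : ColdFreeIdx H → EuclideanSpace ℝ (Fin (dimE ρ))) {x : Site 4}
    (hx : ∀ k : Fin 4, 1 ≤ x k ∧ x k + 1 ≤ 2 * (H : ℤ)) : chartCfgE ρ w (x, 0) = 1 := by
  rw [chartCfgE_apply, extZero_of_forest w ⟨rfl, hx⟩, expChart_zero ρ hρ hinj]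

omit [TopologicalSpace G] [CompactSpace G] in
/-- The chart configuration on a free link. -/
theorem chartCfgE_apply_free (w : ColdFreeIdx H → EuclideanSpace ℝ (Fin (dimE ρ))) (e : ColdFreeIdx H) :
    chartCfgE ρ w e.1.1 = expChart ρ (w e) := by
  rw [chartCfgE_apply, extZero_apply_free]

/-- `extZero` is measurable in the free-link data (any measurable structure on the values). -/
theorem measurable_extZero {V : Type*} [Zero V] [MeasurableSpace V] (e : Literature.MathematicalPhysics.QuantumLattice.ZdEdge 4) :
    Measurable fun w : ColdFreeIdx H → V => extZero w e := by
  unfold extZero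
  split_ifs
  · exact measurable_const
  · exact measurable_pi_apply _
  · exact measurable_const

/-- The chart configuration is measurable in the chart data. -/
theorem measurable_chartCfgE [MeasurableSpace G] [BorelSpace G] (hρ : Continuous ρ) (hinj : Function.Injective ρ) :
    Measurable (chartCfgE (H := H) ρ) :=
  measurable_pi_lambda _ fun e => (measurable_expChart ρ hρ hinj).comp (measurable_extZero e)

end Chart

/-! ## `D` colour copies of the Dirichlet variables, and the unscaling `a = t/√β` -/

/-- `D` colour copies of the free Dirichlet edge variables of D1' (`boxDirichlet H` lives on `EuclideanSpace ℝ (DirFree H)`);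
`TSpace H` is the case `D = 3`. -/
abbrev TSpaceD (H D : ℕ) : Type := Fin D → EuclideanSpace ℝ (DirFree H)

/-- **The Gaussian reference of the one-scale expansion**: `D` independent colour copies of the Dirichlet Gaussian D1',
`boxDirichlet H ^{⊗D}` on `TSpaceD H D` (`gauss3 H` is the case `D = 3`). -/
abbrev gaussD (H D : ℕ) : Measure (TSpaceD H D) := Measure.pi fun _ : Fin D => boxDirichlet H

/-- `gaussD` is a probability measure (found by instance inference through the `abbrev`; recorded as a theorem). -/
theorem isProbabilityMeasure_gaussD (H D : ℕ) : IsProbabilityMeasure (gaussD H D) := inferInstance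

/-- **The quadratic (Gaussian) surrogate of `β·cost_p`** with `D` colours: `qObsD H D p t = ½ Σ_i (dirCirc H p (t i))²`. -/
def qObsD (H D : ℕ) (p : Plaq 4) (t : TSpaceD H D) : ℝ := 1 / 2 * ∑ i, dirCirc H p (t i) ^ 2

/-- `qObsD` is nonnegative. -/
theorem qObsD_nonneg (D : ℕ) (p : Plaq 4) (t : TSpaceD H D) : 0 ≤ qObsD H D p t := by
  unfold qObsD; positivity

/-- `qObsD` as a colour sum. -/
theorem qObsD_eq_sum (D : ℕ) (p : Plaq 4) (t : TSpaceD H D) : qObsD H D p t = ∑ i, 1 / 2 * dirCirc H p (t i) ^ 2 := by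
  rw [qObsD, Finset.mul_sum]

/-- `qObsD` is measurable. -/
theorem measurable_qObsD (D : ℕ) (p : Plaq 4) : Measurable (qObsD H D p) := by
  unfold qObsD
  exact measurable_const.mul (Finset.measurable_sum _ fun i _ => ((measurable_dirCirc p).comp (measurable_pi_apply i)).pow_const 2)

variable (H) in
/-- **Unscaling**: the free-link chart data `a_e = (t^i_e)_{i < D} / √β` of the colour tuple `t`, the free links of the forest gauge being
identified with the free Dirichlet edges by `dirFreeEquiv`. -/
def unscaleTE (D : ℕ) (β : ℝ) (t : TSpaceD H D) : ColdFreeIdx H → EuclideanSpace ℝ (Fin D) :=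
  fun e => WithLp.toLp 2 fun i => t i ((dirFreeEquiv H).symm e) / Real.sqrt β

/-- A coordinate of the unscaled data. -/
@[simp] theorem unscaleTE_apply (D : ℕ) (β : ℝ) (t : TSpaceD H D) (e : ColdFreeIdx H) (i : Fin D) :
    unscaleTE H D β t e i = t i ((dirFreeEquiv H).symm e) / Real.sqrt β := rfl

/-- **The zero extension of the unscaled data is the glued Dirichlet field, unscaled**:
`(extZero (unscaleTE H D β t) e) i = dirGlue H (t i) e / √β`. -/
theorem extZero_unscaleTE_apply (D : ℕ) (β : ℝ) (t : TSpaceD H D) (e : Literature.MathematicalPhysics.QuantumLattice.ZdEdge 4)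
    (i : Fin D) : extZero (unscaleTE H D β t) e i = dirGlue H (WithLp.ofLp (t i)) e / Real.sqrt β := by
  have h1 : (extZero (unscaleTE H D β t) e) i = extZero (fun f => (unscaleTE H D β t f) i) e :=
    map_extZero (fun v : EuclideanSpace ℝ (Fin D) => v i) rfl _ e
  rw [h1]
  simp only [unscaleTE_apply]
  rw [extZero_div]
  congr 1
  -- the scalar statement is colour `i` of the `SU(2)` lemma `extZero_unscaleT` with `√(2β)` replaced; we redo it
  by_cases he : e ∈ boxEdges 4 (2 * H + 1)
  · by_cases hf : (e.2 = 0 ∧ ∀ k : Fin 4, 1 ≤ e.1 k ∧ e.1 k + 1 ≤ 2 * (H : ℤ))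
    · rw [extZero_of_forest _ hf]
      obtain ⟨x, j⟩ := e
      obtain ⟨hj, hx⟩ := hf
      simp only at hj hx
      subst hj
      exact (dirGlue_eq_zero_of_forest _ fun k => ⟨(hx k).1, by exact_mod_cast (hx k).2⟩).symm
    · have hfree : e ∈ dirFreeEdges H := mem_dirFreeEdges.2 ⟨he, hf⟩
      have hbig : e ∈ boxEdgesAt dirCorner (2 * H + 3) := boxEdges_subset_boxEdgesAt_dirCorner H he
      have key : extZero (fun f => t i ((dirFreeEquiv H).symm f)) e = t i ((dirFreeEquiv H).symm ⟨⟨e, he⟩, hf⟩) := by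
        unfold extZero
        rw [dif_pos he, dif_neg hf]
      rw [key, dirGlue]
      have hpin : ¬ (e ∉ dirFreeEdges H) := not_not.2 hfree
      rw [show glue (pin := fun e => e ∉ dirFreeEdges H) dirCorner (2 * H + 3) 0 (WithLp.ofLp (t i)) e =
        WithLp.ofLp (t i) ⟨⟨e, hbig⟩, hpin⟩ from glue_apply_free 0 (WithLp.ofLp (t i)) ⟨⟨e, hbig⟩, hpin⟩]
      rfl
  · rw [extZero_of_not_mem _ he, dirGlue_eq_zero_of_not_mem _ he]

/-- **Chart circulations are Dirichlet circulations**: colour `i` of the circulation of `extZero (unscaleTE t)` around `p` is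
`dirCirc H p (t i) / √β`. -/
theorem sCirc_extZero_unscaleTE (D : ℕ) (β : ℝ) (t : TSpaceD H D) (p : Plaq 4) (i : Fin D) :
    sCirc (fun e => extZero (unscaleTE H D β t) e i) p = dirCirc H p (t i) / Real.sqrt β := by
  simp only [extZero_unscaleTE_apply, sCirc, dirCirc_apply]
  ring

/-- `unscaleTE` is measurable (indeed linear). -/
theorem measurable_unscaleTE (D : ℕ) (β : ℝ) : Measurable (unscaleTE H D β) := by
  refine measurable_pi_lambda _ fun e => ?_
  refine (PiLp.continuous_toLp 2 _).measurable.comp ?_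
  refine measurable_pi_lambda _ fun i => ?_
  change Measurable fun t : TSpaceD H D => t i ((dirFreeEquiv H).symm e) / Real.sqrt β
  refine Measurable.div_const ?_ _
  have h1 : Measurable fun t : TSpaceD H D => t i := measurable_pi_apply i
  have h2 : Measurable fun s : EuclideanSpace ℝ (DirFree H) => s ((dirFreeEquiv H).symm e) :=
    (measurable_pi_apply ((dirFreeEquiv H).symm e)).comp (PiLp.continuous_ofLp 2 _).measurable
  exact h2.comp h1

variable (H) in
/-- **Scaling**: the colour tuple `t^i_e = √β · (w_e)_i` of free-link chart data `w` (inverse to `unscaleTE` for `β > 0`). -/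
def scaleTE (D : ℕ) (β : ℝ) (w : ColdFreeIdx H → EuclideanSpace ℝ (Fin D)) : TSpaceD H D :=
  fun i => WithLp.toLp 2 (fun e : DirFree H => Real.sqrt β * w (dirFreeEquiv H e) i)

/-- `unscaleTE ∘ scaleTE = id` (`β > 0`). -/
theorem unscaleTE_scaleTE (D : ℕ) {β : ℝ} (hβ : 0 < β) (w : ColdFreeIdx H → EuclideanSpace ℝ (Fin D)) :
    unscaleTE H D β (scaleTE H D β w) = w := by
  have hc : Real.sqrt β ≠ 0 := (Real.sqrt_pos.2 hβ).ne'
  funext e; ext i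
  simp only [unscaleTE, scaleTE, Equiv.apply_symm_apply, PiLp.toLp_apply]
  exact mul_div_cancel_left₀ _ hc

/-- `scaleTE ∘ unscaleTE = id` (`β > 0`). -/
theorem scaleTE_unscaleTE (D : ℕ) {β : ℝ} (hβ : 0 < β) (t : TSpaceD H D) : scaleTE H D β (unscaleTE H D β t) = t := by
  have hc : Real.sqrt β ≠ 0 := (Real.sqrt_pos.2 hβ).ne'
  funext i; ext e
  simp only [unscaleTE, scaleTE, Equiv.symm_apply_apply, PiLp.toLp_apply]
  exact mul_div_cancel₀ _ hc

variable (H) in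
/-- **The scaling as a continuous linear equivalence** `(ColdFreeIdx H → ℝ^D) ≃L[ℝ] TSpaceD H D` (`β > 0`): the change of variables of
the one-scale expansion (its Jacobian is a constant, which cancels in normalised expectations). -/
def scaleEquivE (D : ℕ) {β : ℝ} (hβ : 0 < β) : (ColdFreeIdx H → EuclideanSpace ℝ (Fin D)) ≃L[ℝ] TSpaceD H D :=
  LinearEquiv.toContinuousLinearEquiv
    { toFun := scaleTE H D β
      invFun := unscaleTE H D β
      map_add' := fun w w' => by
        funext i; ext e; simp [scaleTE, mul_add]
      map_smul' := fun c w => by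
        funext i; ext e; simp [scaleTE]; ring
      left_inv := unscaleTE_scaleTE D hβ
      right_inv := scaleTE_unscaleTE D hβ }

/-- The scaling equivalence is `scaleTE`. -/
@[simp] theorem scaleEquivE_apply (D : ℕ) {β : ℝ} (hβ : 0 < β) (w : ColdFreeIdx H → EuclideanSpace ℝ (Fin D)) :
    scaleEquivE H D hβ w = scaleTE H D β w := rfl

/-- Its inverse is `unscaleTE`. -/
@[simp] theorem scaleEquivE_symm_apply (D : ℕ) {β : ℝ} (hβ : 0 < β) (t : TSpaceD H D) :
    (scaleEquivE H D hβ).symm t = unscaleTE H D β t := rfl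

/-! ## The chart configuration of a colour tuple, the good event and the tilt -/

variable (H) in
/-- **The chart configuration of a colour tuple** `t`: links `ψ(t_e/√β)` on the free links, `1` elsewhere. -/
def cfgTE (β : ℝ) (t : TSpaceD H (dimE ρ)) : LGConfig 4 G := chartCfgE ρ (unscaleTE H (dimE ρ) β t)

/-- `cfgTE` unfolded. -/
theorem cfgTE_eq (β : ℝ) (t : TSpaceD H (dimE ρ)) : cfgTE ρ H β t = chartCfgE ρ (unscaleTE H (dimE ρ) β t) := rfl

/-- `cfgTE` is measurable. -/
theorem measurable_cfgTE [TopologicalSpace G] [CompactSpace G] [MeasurableSpace G] [BorelSpace G] (hρ : Continuous ρ)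
    (hinj : Function.Injective ρ) (β : ℝ) : Measurable (cfgTE ρ H β) :=
  (measurable_chartCfgE ρ hρ hinj).comp (measurable_unscaleTE _ β)

variable (H) in
/-- **The small-field event read in the colour variables**: `cfgTE ρ H β t ∈ coldGoodSetG ρ H β ε` (every plaquette touching the cold
box has cost `< β^{2ε−1}` in the chart configuration). -/
def goodTE (β ε : ℝ) : Set (TSpaceD H (dimE ρ)) := {t | cfgTE ρ H β t ∈ coldGoodSetG ρ H β ε}

/-- Membership in `goodTE`. -/
theorem mem_goodTE_iff (β ε : ℝ) (t : TSpaceD H (dimE ρ)) : t ∈ goodTE ρ H β ε ↔ cfgTE ρ H β t ∈ coldGoodSetG ρ H β ε := Iff.rfl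

/-- `goodTE` is measurable. -/
theorem measurableSet_goodTE [TopologicalSpace G] [IsTopologicalGroup G] [CompactSpace G] [MeasurableSpace G] [BorelSpace G]
    [SecondCountableTopology G] (hρ : Continuous ρ) (hinj : Function.Injective ρ) (β ε : ℝ) :
    MeasurableSet (goodTE ρ H β ε) :=
  measurable_cfgTE ρ hρ hinj β (measurableSet_coldGoodSetG ρ hρ β ε)

variable (H) in
/-- **The tilt exponent** of the one-scale expansion: (quadratic surrogate minus `β`·cost, summed over the plaquettes touching the
cold box) plus the logarithm of the normalised chart density `Π_e g(a_e)` (the Haar measure of `G` read in the exponential chart is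
`c_H · g · Lebesgue` on small balls, `κE(r)^{−D} ≤ g ≤ 1`; `g` is a parameter).  On `goodTE` it is uniformly small (cubic Taylor
remainder per plaquette, `D·log κE(r) ≤ 16·D·r` per link). -/
def tiltWE (g : EuclideanSpace ℝ (Fin (dimE ρ)) → ℝ) (β : ℝ) (t : TSpaceD H (dimE ρ)) : ℝ :=
  (∑ q ∈ plaquettesTouching (boxEdges 4 (2 * H + 1)),
      (qObsD H (dimE ρ) (q.1, q.2.1.1, q.2.1.2) t - β * plaqCostAt ρ q.1 q.2.1.1 q.2.1.2 (cfgTE ρ H β t))) +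
    ∑ e : ColdFreeIdx H, Real.log (g (unscaleTE H (dimE ρ) β t e))

/-- `tiltWE` is measurable (measurable density `g`). -/
theorem measurable_tiltWE [TopologicalSpace G] [IsTopologicalGroup G] [CompactSpace G] [MeasurableSpace G] [BorelSpace G]
    [SecondCountableTopology G] (hρ : Continuous ρ) (hinj : Function.Injective ρ)
    {g : EuclideanSpace ℝ (Fin (dimE ρ)) → ℝ} (hg : Measurable g) (β : ℝ) : Measurable (tiltWE ρ H g β) := by
  unfold tiltWE
  refine (Finset.measurable_sum _ fun q _ => (measurable_qObsD _ _).sub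
    (measurable_const.mul ((measurable_plaqCostAt_of_continuous ρ hρ _ _ _).comp (measurable_cfgTE ρ hρ hinj β)))).add
    (Finset.measurable_sum _ fun e _ => Real.measurable_log.comp (hg.comp ((measurable_pi_apply e).comp (measurable_unscaleTE _ β))))

end Summit.QuantumFields.YangMills.Theorems.ColdBoxAllGroups

end
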